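import Mathlib
import HarnessLib

/-!
# Contractive maps (Nemytzki–Edelstein) and `φ`-contractions with comparison functions
# (Matkowski–Rus): Picard iteration, fixed points and error estimates

Source: V. Berinde, *Iterative Approximation of Fixed Points*, 2nd ed., Lecture Notes in
Mathematics 1912, Springer (2007) [Berinde2007], Chapter 2, §2.2 (Theorem 2.2 = theorem of
Nemytzki–Edelstein, Corollary 2.2) and §2.5 (comparison functions: conditions (i_φ)–(vi_φ),
Lemma 2.1, Lemma 2.2, Definition 2.3; `φ`-contractions (19); Theorem 2.7; Corollary 2.4;
Theorem 2.8 with the estimate (22) and the Remark 1 after it).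

Let `(X, d)` be a metric space and `T : X → X`.

* §2.2.  `T` is *contractive* if `d(Tx, Ty) < d(x, y)` for `x ≠ y` (`IsContractive`).
  Theorem 2.2 (Nemytzki–Edelstein): on a compact metric space a contractive map is a strict
  Picard operator — it has exactly one fixed point and every Picard sequence `Tⁿ x₀` converges to
  it (`IsContractive.existsUnique_fixedPoint_of_compactSpace`,
  `IsContractive.tendsto_iterate_fixedPoint`).  Corollary 2.2: in any metric space, if some
  Picard sequence of a contractive map has a convergent subsequence, its limit is the (unique)
  fixed point and the whole sequence converges to it (`IsContractive.of_tendsto_subseq`).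
* §2.5.  A *comparison function* is a monotone increasing `φ : ℝ₊ → ℝ₊` with `φⁿ(t) → 0` for all
  `t ≥ 0` ((i_φ) + (v_φ), Definition 2.3 (1); `IsComparisonFunction`); then `φ(0) = 0` and
  `φ(t) < t` for `t > 0` (Lemma 2.1 (3), Lemma 2.2 (3); `IsComparisonFunction.map_zero`,
  `IsComparisonFunction.lt_self`).  A *(c)-comparison function* has moreover `∑ₙ φⁿ(t) < ∞`
  ((vi_φ), Definition 2.3 (2); `IsCComparisonFunction`), and is a comparison function
  (Lemma 2.2 (1); `IsCComparisonFunction.isComparisonFunction`).  `T` is a `φ`-*contraction* if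
  `d(Tx, Ty) ≤ φ(d(x, y))` ((19); `IsPhiContraction`).
  Theorem 2.7 (Matkowski–Rus): a `φ`-contraction on a complete metric space is a Picard mapping —
  `d(xₙ, xₙ₊₁) ≤ φⁿ(d(x₀, x₁)) → 0` ((20), `IsPhiContraction.dist_iterate_succ_le`), the closed
  ball `B̄(x, ε)` is `T`-invariant as soon as `d(x, Tx) ≤ ε - φ(ε)`
  (`IsPhiContraction.mapsTo_closedBall`), hence every Picard sequence is Cauchy
  (`IsPhiContraction.cauchySeq_iterate`), its limit is a fixed point, the fixed point is unique,
  and `d(Tⁿ x₀, x*) ≤ φⁿ(d(x₀, x*))` (`IsPhiContraction.existsUnique_fixedPoint`,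
  `IsPhiContraction.tendsto_iterate_fixedPoint`, `IsPhiContraction.dist_iterate_fixedPoint_le`).
  Corollary 2.4: if some iterate `Tᵏ` is a `φ`-contraction then `T` has exactly one fixed point
  (`IsPhiContraction.existsUnique_fixedPoint_of_iterate`).
  Theorem 2.8 (iii): for a (c)-comparison function, the a posteriori estimate (22)
  `d(xₙ, x*) ≤ s(d(xₙ, xₙ₊₁))`, `s(t) = ∑ₖ φᵏ(t)`
  (`IsPhiContraction.dist_iterate_fixedPoint_le_tsum`)
  and the a priori form of Remark 1, `d(xₙ, x*) ≤ ∑ₘ φⁿ⁺ᵐ(d(x₀, x₁))`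
  (`IsPhiContraction.dist_iterate_fixedPoint_le_tsum_apriori`).

Deviations from the source.  (a) Comparison functions are taken as maps `φ : ℝ → ℝ` that are
monotone on all of `ℝ`, nonnegative on `[0, ∞)` and satisfy (v_φ) (resp. (vi_φ)) on `[0, ∞)`;
a comparison function on `ℝ₊` in the book's sense extends to such a map by `φ(t) = 0` for
`t < 0`, so nothing is lost.  (b) In Theorem 2.7 the convergence `Tⁿ x₀ → x*` to a fixed point
`x*` and the bound `d(Tⁿ x₀, x*) ≤ φⁿ(d(x₀, x*))` are proved without completeness (only the
existence of `x*` uses it); likewise Corollary 2.2 needs no completeness.  (c) Theorem 2.2 is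
derived from Corollary 2.2, whose proof follows the book (monotone step lengths, a convergent
subsequence, `d(x*, Tx*) = d(Tx*, T²x*)`).
-/

open Filter Topology Function Set Metric

namespace Literature.Analysis.Convex.PhiContractions

variable {X : Type*} [MetricSpace X]

/-! ## §2.2 Contractive maps: Theorem 2.2 (Nemytzki–Edelstein) and Corollary 2.2 -/

/-- `T` is *contractive*: `d(Tx, Ty) < d(x, y)` whenever `x ≠ y`.
[cite: Berinde2007, Ch. 2 §2.2] -/
def IsContractive (T : X → X) : Prop := ∀ x y, x ≠ y → dist (T x) (T y) < dist x y

namespace IsContractive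

variable {T : X → X}

/-- A contractive map is nonexpansive. [cite: Berinde2007, Ch. 2 §2.2] -/
theorem dist_le (h : IsContractive T) (x y : X) : dist (T x) (T y) ≤ dist x y := by
  by_cases hxy : x = y
  · simp [hxy]
  · exact (h x y hxy).le

/-- A contractive map is continuous (indeed `1`-Lipschitz).
[cite: Berinde2007, Ch. 2 Thm 2.2 (proof)] -/
theorem continuous (h : IsContractive T) : Continuous T :=
  (LipschitzWith.mk_one h.dist_le).continuous

/-- A contractive map has at most one fixed point (`card F_T ≤ 1`).
[cite: Berinde2007, Ch. 2 Thm 2.2 (proof)] -/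
theorem fixedPoint_unique (h : IsContractive T) {p q : X} (hp : T p = p) (hq : T q = q) :
    p = q := by
  by_contra hpq
  have := h p q hpq
  rw [hp, hq] at this
  exact lt_irrefl _ this

/-- Along a Picard sequence of a contractive map the step lengths `d(xₙ, xₙ₊₁)` do not increase.
[cite: Berinde2007, Ch. 2 Thm 2.2 (proof)] -/
theorem antitone_dist_iterate_succ (h : IsContractive T) (x₀ : X) :
    Antitone fun n => dist (T^[n] x₀) (T^[n + 1] x₀) := by
  refine antitone_nat_of_succ_le fun n => ?_
  rw [iterate_succ_apply' T (n + 1), iterate_succ_apply' T n]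
  exact h.dist_le _ _

/-- For a fixed point `p` of a contractive map, `d(Tⁿ⁺¹ x₀, p) ≤ d(Tⁿ x₀, p)`.
[cite: Berinde2007, Ch. 2 Thm 2.2 (proof)] -/
theorem dist_iterate_succ_fixedPoint_le (h : IsContractive T) {p : X} (hp : T p = p) (x₀ : X)
    (n : ℕ) : dist (T^[n + 1] x₀) p ≤ dist (T^[n] x₀) p := by
  rw [iterate_succ_apply']
  calc dist (T (T^[n] x₀)) p = dist (T (T^[n] x₀)) (T p) := by rw [hp]
    _ ≤ dist (T^[n] x₀) p := h.dist_le _ _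

/-- If `d(Tⁿ x₀, p)` has a subsequence tending to `0` for a fixed point `p`, the whole Picard
sequence converges to `p` (the distances are nonincreasing).
[cite: Berinde2007, Ch. 2 Thm 2.2 (proof)] -/
theorem tendsto_iterate_of_subseq (h : IsContractive T) {p : X} (hp : T p = p) (x₀ : X)
    {ns : ℕ → ℕ} (hlim : Tendsto (fun k => T^[ns k] x₀) atTop (𝓝 p)) :
    Tendsto (fun n => T^[n] x₀) atTop (𝓝 p) := by
  have hanti : Antitone fun n => dist (T^[n] x₀) p :=
    antitone_nat_of_succ_le fun n => h.dist_iterate_succ_fixedPoint_le hp x₀ n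
  rw [tendsto_iff_dist_tendsto_zero]
  rw [tendsto_iff_dist_tendsto_zero] at hlim
  refine Metric.tendsto_atTop.2 fun ε hε => ?_
  obtain ⟨k, hk⟩ := (Metric.tendsto_atTop.1 hlim) ε hε
  refine ⟨ns k, fun n hn => ?_⟩
  have h1 := hk k le_rfl
  rw [Real.dist_0_eq_abs, abs_of_nonneg dist_nonneg] at h1 ⊢
  exact (hanti hn).trans_lt h1

/-- Corollary 2.2: if a Picard sequence `Tⁿ x₀` of a contractive map has a subsequence converging
to `p`, then `p` is a fixed point (the unique one) and the whole sequence converges to `p`.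
No completeness is needed.
[cite: Berinde2007, Ch. 2 Cor 2.2] -/
theorem of_tendsto_subseq (h : IsContractive T) (x₀ : X) {ns : ℕ → ℕ} (hns : StrictMono ns)
    {p : X} (hlim : Tendsto (fun k => T^[ns k] x₀) atTop (𝓝 p)) :
    T p = p ∧ Tendsto (fun n => T^[n] x₀) atTop (𝓝 p) := by
  -- the step lengths `aₙ = d(xₙ, xₙ₊₁)` are nonincreasing and bounded below, hence converge
  set a : ℕ → ℝ := fun n => dist (T^[n] x₀) (T^[n + 1] x₀) with ha_def
  have ha : Tendsto a atTop (𝓝 (⨅ n, a n)) :=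
    tendsto_atTop_ciInf (h.antitone_dist_iterate_succ x₀) ⟨0, by
      rintro _ ⟨n, rfl⟩; exact dist_nonneg⟩
  -- along the subsequence, `a (ns k) → d(p, Tp)` and `a (ns k + 1) → d(Tp, T²p)`
  have hT1 : Tendsto (fun k => T^[ns k + 1] x₀) atTop (𝓝 (T p)) := by
    simp_rw [iterate_succ_apply']
    exact (h.continuous.tendsto p).comp hlim
  have hT2 : Tendsto (fun k => T^[ns k + 2] x₀) atTop (𝓝 (T (T p))) := by
    have : ∀ k, T^[ns k + 2] x₀ = T (T^[ns k + 1] x₀) := fun k => iterate_succ_apply' T _ x₀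
    simp_rw [this]
    exact (h.continuous.tendsto (T p)).comp hT1
  have hsub1 : Tendsto (fun k => a (ns k)) atTop (𝓝 (dist p (T p))) := hlim.dist hT1
  have hsub2 : Tendsto (fun k => a (ns k + 1)) atTop (𝓝 (dist (T p) (T (T p)))) := hT1.dist hT2
  have hl1 : dist p (T p) = ⨅ n, a n :=
    tendsto_nhds_unique hsub1 (ha.comp hns.tendsto_atTop)
  have hl2 : dist (T p) (T (T p)) = ⨅ n, a n :=
    tendsto_nhds_unique hsub2
      (ha.comp ((tendsto_add_atTop_nat 1).comp hns.tendsto_atTop))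
  -- hence `d(Tp, T²p) = d(p, Tp)`, which forces `Tp = p`
  have hfix : T p = p := by
    by_contra hne
    have hlt := h p (T p) (Ne.symm hne)
    rw [hl1, hl2] at hlt
    exact lt_irrefl _ hlt
  exact ⟨hfix, h.tendsto_iterate_of_subseq hfix x₀ hlim⟩

/-- Theorem 2.2 (Nemytzki–Edelstein), existence and uniqueness: a contractive self-map of a
nonempty compact metric space has exactly one fixed point.
[cite: Berinde2007, Ch. 2 Thm 2.2] -/
theorem existsUnique_fixedPoint_of_compactSpace [CompactSpace X] [Nonempty X]
    (h : IsContractive T) : ∃! p : X, T p = p := by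
  obtain ⟨p, -, ns, hns, hlim⟩ :=
    isCompact_univ.tendsto_subseq (x := fun n => T^[n] (Classical.arbitrary X))
      fun n => mem_univ _
  have hp := (h.of_tendsto_subseq (Classical.arbitrary X) hns hlim).1
  exact ⟨p, hp, fun q hq => h.fixedPoint_unique hq hp⟩

/-- Theorem 2.2 (Nemytzki–Edelstein), convergence: on a compact metric space every Picard
sequence of a contractive map converges to its fixed point (`T` is a strict Picard operator).
[cite: Berinde2007, Ch. 2 Thm 2.2] -/
theorem tendsto_iterate_fixedPoint [CompactSpace X] (h : IsContractive T) {p : X}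
    (hp : T p = p) (x₀ : X) : Tendsto (fun n => T^[n] x₀) atTop (𝓝 p) := by
  obtain ⟨q, -, ns, hns, hlim⟩ :=
    isCompact_univ.tendsto_subseq (x := fun n => T^[n] x₀) fun n => mem_univ _
  obtain ⟨hq, hconv⟩ := h.of_tendsto_subseq x₀ hns hlim
  rwa [h.fixedPoint_unique hp hq]

end IsContractive

/-! ## §2.5 Comparison functions -/

/-- A *comparison function* (Definition 2.3 (1)): `φ` is monotone increasing ((i_φ)) and
`φⁿ(t) → 0` for every `t ≥ 0` ((v_φ)); we also record that `φ` maps `[0, ∞)` to itself.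
[cite: Berinde2007, Ch. 2 §2.5 Def 2.3 (1)] -/
structure IsComparisonFunction (φ : ℝ → ℝ) : Prop where
  mono : Monotone φ
  nonneg : ∀ t, 0 ≤ t → 0 ≤ φ t
  tendsto_iterate_zero : ∀ t, 0 ≤ t → Tendsto (fun n => φ^[n] t) atTop (𝓝 0)

/-- A *(c)-comparison function* (Definition 2.3 (2)): `φ` is monotone increasing ((i_φ)) and the
comparison series `∑ₙ φⁿ(t)` converges for every `t ≥ 0` ((vi_φ)).
[cite: Berinde2007, Ch. 2 §2.5 Def 2.3 (2)] -/
structure IsCComparisonFunction (φ : ℝ → ℝ) : Prop where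
  mono : Monotone φ
  nonneg : ∀ t, 0 ≤ t → 0 ≤ φ t
  summable_iterate : ∀ t, 0 ≤ t → Summable fun n => φ^[n] t

namespace IsComparisonFunction

variable {φ : ℝ → ℝ}

/-- Iterates of a comparison function are nonnegative on `[0, ∞)`.
[cite: Berinde2007, Ch. 2 §2.5 Lemma 2.2 (5)] -/
theorem iterate_nonneg (hφ : IsComparisonFunction φ) {t : ℝ} (ht : 0 ≤ t) (n : ℕ) :
    0 ≤ φ^[n] t := by
  induction n with
  | zero => simpa
  | succ n ih => rw [iterate_succ_apply']; exact hφ.nonneg _ ih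

/-- Lemma 2.2 (3): a comparison function satisfies (iii_φ), `φ(0) = 0`.
[cite: Berinde2007, Ch. 2 §2.5 Lemma 2.2 (3)] -/
theorem map_zero (hφ : IsComparisonFunction φ) : φ 0 = 0 := by
  have h0 : 0 ≤ φ 0 := hφ.nonneg 0 le_rfl
  -- the iterates at `0` increase: `φ(0) ≤ φⁿ⁺¹(0)`
  have hle : ∀ n, φ 0 ≤ φ^[n + 1] 0 := by
    intro n
    induction n with
    | zero => simp
    | succ n ih =>
      rw [iterate_succ_apply']
      calc φ 0 ≤ φ (φ 0) := hφ.mono h0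
        _ ≤ φ (φ^[n + 1] 0) := hφ.mono ih
  have hlim : Tendsto (fun n => φ^[n + 1] 0) atTop (𝓝 0) :=
    (hφ.tendsto_iterate_zero 0 le_rfl).comp (tendsto_add_atTop_nat 1)
  have : φ 0 ≤ 0 := ge_of_tendsto' hlim hle
  exact le_antisymm this h0

/-- Lemma 2.1 (3): (i_φ) and (v_φ) imply (ii_φ), `φ(t) < t` for `t > 0`.
[cite: Berinde2007, Ch. 2 §2.5 Lemma 2.1 (3)] -/
theorem lt_self (hφ : IsComparisonFunction φ) {t : ℝ} (ht : 0 < t) : φ t < t := by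
  by_contra hge
  have hge' : t ≤ φ t := le_of_not_gt hge
  -- then `t ≤ φⁿ(t)` for all `n`, contradicting `φⁿ(t) → 0`
  have hle : ∀ n, t ≤ φ^[n] t := by
    intro n
    induction n with
    | zero => simp
    | succ n ih =>
      rw [iterate_succ_apply']
      exact hge'.trans (hφ.mono ih)
  have : t ≤ 0 := ge_of_tendsto' (hφ.tendsto_iterate_zero t ht.le) hle
  exact absurd this (not_le.2 ht)

/-- `φ(t) ≤ t` for `t ≥ 0`. [cite: Berinde2007, Ch. 2 §2.5 Lemma 2.1 (3)] -/
theorem le_self (hφ : IsComparisonFunction φ) {t : ℝ} (ht : 0 ≤ t) : φ t ≤ t := by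
  rcases ht.eq_or_lt with rfl | ht'
  · exact (hφ.map_zero).le
  · exact (hφ.lt_self ht').le

/-- `ε - φ(ε) > 0` for `ε > 0` (the `δ(ε)` of the proof of Theorem 2.7).
[cite: Berinde2007, Ch. 2 Thm 2.7 (proof)] -/
theorem sub_self_pos (hφ : IsComparisonFunction φ) {ε : ℝ} (hε : 0 < ε) : 0 < ε - φ ε :=
  sub_pos.2 (hφ.lt_self hε)

end IsComparisonFunction

namespace IsCComparisonFunction

variable {φ : ℝ → ℝ}

/-- Lemma 2.2 (1): a (c)-comparison function is a comparison function.
[cite: Berinde2007, Ch. 2 §2.5 Lemma 2.2 (1)] -/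
theorem isComparisonFunction (hφ : IsCComparisonFunction φ) : IsComparisonFunction φ where
  mono := hφ.mono
  nonneg := hφ.nonneg
  tendsto_iterate_zero t ht := (hφ.summable_iterate t ht).tendsto_atTop_zero

/-- Lemma 2.2 (6), nonnegativity of the sum `s(t) = ∑ₖ φᵏ(t)` of the comparison series.
[cite: Berinde2007, Ch. 2 §2.5 Lemma 2.2 (6)] -/
theorem tsum_iterate_nonneg (hφ : IsCComparisonFunction φ) {t : ℝ} (ht : 0 ≤ t) :
    0 ≤ ∑' k, φ^[k] t :=
  tsum_nonneg fun k => hφ.isComparisonFunction.iterate_nonneg ht k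

/-- Lemma 2.2 (6), monotonicity of `s(t) = ∑ₖ φᵏ(t)` on `[0, ∞)` ((i_φ) for `s`).
[cite: Berinde2007, Ch. 2 §2.5 Lemma 2.2 (6)] -/
theorem tsum_iterate_mono (hφ : IsCComparisonFunction φ) {t u : ℝ} (ht : 0 ≤ t) (htu : t ≤ u) :
    ∑' k, φ^[k] t ≤ ∑' k, φ^[k] u :=
  (hφ.summable_iterate t ht).tsum_le_tsum (fun k => hφ.mono.iterate k htu)
    (hφ.summable_iterate u (ht.trans htu))

/-- Lemma 2.2 (6), `s(0) = 0` ((iii_φ) for `s`).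
[cite: Berinde2007, Ch. 2 §2.5 Lemma 2.2 (6)] -/
theorem tsum_iterate_zero (hφ : IsCComparisonFunction φ) : ∑' k, φ^[k] (0 : ℝ) = 0 := by
  have h0 : ∀ k, φ^[k] (0 : ℝ) = 0 := fun k =>
    iterate_fixed (f := φ) hφ.isComparisonFunction.map_zero k
  simp [h0]

end IsCComparisonFunction

/-! ## §2.5 `φ`-contractions: Theorem 2.7, Corollary 2.4, Theorem 2.8 -/

/-- `T` is a `φ`-*contraction* ((19)): `d(Tx, Ty) ≤ φ(d(x, y))` for all `x, y`.
[cite: Berinde2007, Ch. 2 §2.5 Def 2.3 (19)] -/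
def IsPhiContraction (T : X → X) (φ : ℝ → ℝ) : Prop := ∀ x y, dist (T x) (T y) ≤ φ (dist x y)

namespace IsPhiContraction

variable {T : X → X} {φ : ℝ → ℝ}

/-- A `φ`-contraction with a comparison function `φ` is nonexpansive.
[cite: Berinde2007, Ch. 2 Thm 2.7 (proof)] -/
theorem dist_le (hφ : IsComparisonFunction φ) (h : IsPhiContraction T φ) (x y : X) :
    dist (T x) (T y) ≤ dist x y :=
  (h x y).trans (hφ.le_self dist_nonneg)

/-- A `φ`-contraction with a comparison function `φ` is contractive.
[cite: Berinde2007, Ch. 2 Thm 2.7 (proof)] -/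
theorem isContractive (hφ : IsComparisonFunction φ) (h : IsPhiContraction T φ) :
    IsContractive T := fun x y hxy =>
  (h x y).trans_lt (hφ.lt_self (dist_pos.2 hxy))

/-- "Any `φ`-contraction is continuous."
[cite: Berinde2007, Ch. 2 Thm 2.7 (proof)] -/
theorem continuous (hφ : IsComparisonFunction φ) (h : IsPhiContraction T φ) : Continuous T :=
  (h.isContractive hφ).continuous

/-- Uniqueness of the fixed point of a `φ`-contraction:
`0 < d(x*, y*) ≤ φ(d(x*, y*)) < d(x*, y*)` is impossible.
[cite: Berinde2007, Ch. 2 Thm 2.7] -/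
theorem fixedPoint_unique (hφ : IsComparisonFunction φ) (h : IsPhiContraction T φ) {p q : X}
    (hp : T p = p) (hq : T q = q) : p = q :=
  (h.isContractive hφ).fixedPoint_unique hp hq

/-- (20): `d(Tⁿ x₀, Tⁿ⁺¹ x₀) ≤ φⁿ(d(x₀, T x₀))`.
[cite: Berinde2007, Ch. 2 Thm 2.7 (20)] -/
theorem dist_iterate_succ_le (hφ : IsComparisonFunction φ) (h : IsPhiContraction T φ) (x₀ : X)
    (n : ℕ) : dist (T^[n] x₀) (T^[n + 1] x₀) ≤ φ^[n] (dist x₀ (T x₀)) := by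
  induction n with
  | zero => simp
  | succ n ih =>
    rw [iterate_succ_apply' T n] at ih
    rw [iterate_succ_apply' T (n + 1), iterate_succ_apply' T n, iterate_succ_apply' φ n]
    exact (h _ _).trans (hφ.mono ih)

/-- (20): a `φ`-contraction is asymptotically regular, `d(Tⁿ x₀, Tⁿ⁺¹ x₀) → 0`.
[cite: Berinde2007, Ch. 2 Thm 2.7 (20)] -/
theorem tendsto_dist_iterate_succ (hφ : IsComparisonFunction φ) (h : IsPhiContraction T φ)
    (x₀ : X) : Tendsto (fun n => dist (T^[n] x₀) (T^[n + 1] x₀)) atTop (𝓝 0) :=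
  squeeze_zero (fun _ => dist_nonneg) (h.dist_iterate_succ_le hφ x₀)
    (hφ.tendsto_iterate_zero _ dist_nonneg)

/-- The key step of Theorem 2.7: if `d(x, Tx) ≤ ε - φ(ε)` then the closed ball `B̄(x, ε)` is
invariant under `T`.
[cite: Berinde2007, Ch. 2 Thm 2.7 (proof)] -/
theorem mapsTo_closedBall (hφ : IsComparisonFunction φ) (h : IsPhiContraction T φ) {x : X}
    {ε : ℝ} (hx : dist x (T x) ≤ ε - φ ε) : MapsTo T (closedBall x ε) (closedBall x ε) := by
  intro y hy
  rw [mem_closedBall] at hy ⊢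
  calc dist (T y) x ≤ dist (T y) (T x) + dist (T x) x := dist_triangle _ _ _
    _ ≤ φ (dist y x) + dist x (T x) := add_le_add (h y x) (dist_comm (T x) x).le
    _ ≤ φ ε + (ε - φ ε) := add_le_add (hφ.mono hy) hx
    _ = ε := by ring

/-- Consequence of the invariant ball: if `ε ≥ 0` and `d(xₙ, xₙ₊₁) ≤ ε - φ(ε)` then
`d(xₘ, xₙ) ≤ ε` for all `m ≥ n` ("`Tᵐ x₀ ∈ B̄(Tⁿ x₀; ε)`").
[cite: Berinde2007, Ch. 2 Thm 2.7 (proof)] -/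
theorem dist_iterate_le_of_step_le (hφ : IsComparisonFunction φ) (h : IsPhiContraction T φ)
    (x₀ : X) {ε : ℝ} (hε : 0 ≤ ε) {n : ℕ} (hn : dist (T^[n] x₀) (T^[n + 1] x₀) ≤ ε - φ ε)
    {m : ℕ} (hm : n ≤ m) : dist (T^[m] x₀) (T^[n] x₀) ≤ ε := by
  have hball := h.mapsTo_closedBall hφ (x := T^[n] x₀) (ε := ε)
    (by rwa [← iterate_succ_apply' T n x₀])
  have key : ∀ k, T^[n + k] x₀ ∈ closedBall (T^[n] x₀) ε := by
    intro k
    induction k with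
    | zero => simpa using hε
    | succ k ih =>
      have : T^[n + (k + 1)] x₀ = T (T^[n + k] x₀) := by
        rw [← add_assoc, iterate_succ_apply']
      rw [this]
      exact hball ih
  obtain ⟨k, rfl⟩ := Nat.exists_eq_add_of_le hm
  exact mem_closedBall.1 (key k)

/-- Theorem 2.7 (proof): every Picard sequence of a `φ`-contraction is Cauchy.
[cite: Berinde2007, Ch. 2 Thm 2.7 (proof)] -/
theorem cauchySeq_iterate (hφ : IsComparisonFunction φ) (h : IsPhiContraction T φ) (x₀ : X) :
    CauchySeq fun n => T^[n] x₀ := by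
  refine Metric.cauchySeq_iff'.2 fun ε hε => ?_
  have hδ : 0 < ε / 2 - φ (ε / 2) := hφ.sub_self_pos (half_pos hε)
  obtain ⟨N, hN⟩ := (Metric.tendsto_atTop.1 (h.tendsto_dist_iterate_succ hφ x₀)) _ hδ
  refine ⟨N, fun n hn => ?_⟩
  have hstep : dist (T^[N] x₀) (T^[N + 1] x₀) ≤ ε / 2 - φ (ε / 2) := by
    have := hN N le_rfl
    rw [Real.dist_0_eq_abs, abs_of_nonneg dist_nonneg] at this
    exact this.le
  calc dist (T^[n] x₀) (T^[N] x₀) ≤ ε / 2 :=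
      h.dist_iterate_le_of_step_le hφ x₀ (half_pos hε).le hstep hn
    _ < ε := half_lt_self hε

/-- For a fixed point `p`, `d(Tⁿ x₀, p) ≤ φⁿ(d(x₀, p))` (no completeness needed).
[cite: Berinde2007, Ch. 2 Thm 2.7] -/
theorem dist_iterate_fixedPoint_le (hφ : IsComparisonFunction φ) (h : IsPhiContraction T φ)
    {p : X} (hp : T p = p) (x₀ : X) (n : ℕ) : dist (T^[n] x₀) p ≤ φ^[n] (dist x₀ p) := by
  induction n with
  | zero => simp
  | succ n ih =>
    rw [iterate_succ_apply' T n, iterate_succ_apply' φ n]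
    conv_lhs => rw [← hp]
    exact (h _ _).trans (hφ.mono ih)

/-- Every Picard sequence of a `φ`-contraction converges to any fixed point `p` (which is then
unique); no completeness needed.
[cite: Berinde2007, Ch. 2 Thm 2.7] -/
theorem tendsto_iterate_fixedPoint (hφ : IsComparisonFunction φ) (h : IsPhiContraction T φ)
    {p : X} (hp : T p = p) (x₀ : X) : Tendsto (fun n => T^[n] x₀) atTop (𝓝 p) := by
  rw [tendsto_iff_dist_tendsto_zero]
  exact squeeze_zero (fun _ => dist_nonneg) (h.dist_iterate_fixedPoint_le hφ hp x₀)
    (hφ.tendsto_iterate_zero _ dist_nonneg)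

/-- Theorem 2.7, limit step: in a complete metric space every Picard sequence of a
`φ`-contraction converges, and the limit is a fixed point (by continuity of `T`).
[cite: Berinde2007, Ch. 2 Thm 2.7] -/
theorem exists_fixedPoint_tendsto_iterate [CompleteSpace X] (hφ : IsComparisonFunction φ)
    (h : IsPhiContraction T φ) (x₀ : X) :
    ∃ p : X, T p = p ∧ Tendsto (fun n => T^[n] x₀) atTop (𝓝 p) := by
  obtain ⟨p, hp⟩ := cauchySeq_tendsto_of_complete (h.cauchySeq_iterate hφ x₀)
  refine ⟨p, ?_, hp⟩
  have h1 : Tendsto (fun n => T^[n + 1] x₀) atTop (𝓝 (T p)) := by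
    simp_rw [iterate_succ_apply']
    exact ((h.continuous hφ).tendsto p).comp hp
  exact tendsto_nhds_unique h1 (hp.comp (tendsto_add_atTop_nat 1))

/-- Theorem 2.7 (Matkowski–Rus): a `φ`-contraction on a nonempty complete metric space has
exactly one fixed point (and, by `tendsto_iterate_fixedPoint`, is a Picard mapping).
[cite: Berinde2007, Ch. 2 Thm 2.7] -/
theorem existsUnique_fixedPoint [CompleteSpace X] [Nonempty X] (hφ : IsComparisonFunction φ)
    (h : IsPhiContraction T φ) : ∃! p : X, T p = p := by
  obtain ⟨p, hp, -⟩ := h.exists_fixedPoint_tendsto_iterate hφ (Classical.arbitrary X)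
  exact ⟨p, hp, fun q hq => h.fixedPoint_unique hφ hq hp⟩

/-- Corollary 2.4: if some iterate `Tᵏ` is a `φ`-contraction (on a nonempty complete metric
space), then `T` has exactly one fixed point.
[cite: Berinde2007, Ch. 2 Cor 2.4] -/
theorem existsUnique_fixedPoint_of_iterate [CompleteSpace X] [Nonempty X]
    (hφ : IsComparisonFunction φ) {k : ℕ} (h : IsPhiContraction (T^[k]) φ) :
    ∃! p : X, T p = p := by
  obtain ⟨p, hp, huniq⟩ := h.existsUnique_fixedPoint hφ
  -- `T p` is again a fixed point of `Tᵏ`, hence equals `p`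
  have hTp : T^[k] (T p) = T p := by
    rw [← iterate_succ_apply, iterate_succ_apply', hp]
  refine ⟨p, huniq (T p) hTp, fun q hq => huniq q ?_⟩
  exact (IsFixedPt.iterate hq k : T^[k] q = q)

/-- Theorem 2.8 (iii), the a posteriori estimate (22) for a (c)-comparison function:
`d(xₙ, x*) ≤ s(d(xₙ, xₙ₊₁))` with `s(t) = ∑ₖ φᵏ(t)`, for the limit `x*` of the Picard sequence.
[cite: Berinde2007, Ch. 2 Thm 2.8 (22)] -/
theorem dist_iterate_fixedPoint_le_tsum (hφ : IsCComparisonFunction φ) (h : IsPhiContraction T φ)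
    (x₀ : X) {p : X} (hp : Tendsto (fun n => T^[n] x₀) atTop (𝓝 p)) (n : ℕ) :
    dist (T^[n] x₀) p ≤ ∑' k, φ^[k] (dist (T^[n] x₀) (T^[n + 1] x₀)) := by
  -- apply the telescoping bound to the shifted sequence `m ↦ T^[m] (T^[n] x₀) = T^[n + m] x₀`
  have hshift : ∀ m, T^[m] (T^[n] x₀) = T^[m + n] x₀ := fun m => (iterate_add_apply T m n x₀).symm
  have hp' : Tendsto (fun m => T^[m] (T^[n] x₀)) atTop (𝓝 p) := by
    simp_rw [hshift]
    exact hp.comp (tendsto_add_atTop_nat n)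
  have hd : ∀ m, dist (T^[m] (T^[n] x₀)) (T^[m + 1] (T^[n] x₀)) ≤
      φ^[m] (dist (T^[n] x₀) (T^[n + 1] x₀)) := by
    intro m
    have := h.dist_iterate_succ_le hφ.isComparisonFunction (T^[n] x₀) m
    rwa [← iterate_succ_apply' T n x₀] at this
  have := dist_le_tsum_of_dist_le_of_tendsto₀ _ hd (hφ.summable_iterate _ dist_nonneg) hp'
  simpa using this

/-- Remark 1 after Theorem 2.8, the a priori estimate: `d(xₙ, x*) ≤ ∑ₘ φⁿ⁺ᵐ(d(x₀, x₁))`.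
[cite: Berinde2007, Ch. 2 Thm 2.8 Remark 1] -/
theorem dist_iterate_fixedPoint_le_tsum_apriori (hφ : IsCComparisonFunction φ)
    (h : IsPhiContraction T φ) (x₀ : X) {p : X}
    (hp : Tendsto (fun n => T^[n] x₀) atTop (𝓝 p)) (n : ℕ) :
    dist (T^[n] x₀) p ≤ ∑' m, φ^[n + m] (dist x₀ (T x₀)) :=
  dist_le_tsum_of_dist_le_of_tendsto (fun m => φ^[m] (dist x₀ (T x₀)))
    (h.dist_iterate_succ_le hφ.isComparisonFunction x₀) (hφ.summable_iterate _ dist_nonneg) hp n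

/-- Theorem 2.8 (i)–(iii) packaged: for a `φ`-contraction with a (c)-comparison function on a
complete metric space, the Picard sequence from `x₀` converges to the unique fixed point `p` and
(22) holds along it.
[cite: Berinde2007, Ch. 2 Thm 2.8] -/
theorem dist_iterate_fixedPoint_le_tsum' (hφ : IsCComparisonFunction φ)
    (h : IsPhiContraction T φ) {p : X} (hfix : T p = p) (x₀ : X) (n : ℕ) :
    dist (T^[n] x₀) p ≤ ∑' k, φ^[k] (dist (T^[n] x₀) (T^[n + 1] x₀)) :=
  h.dist_iterate_fixedPoint_le_tsum hφ x₀
    (h.tendsto_iterate_fixedPoint hφ.isComparisonFunction hfix x₀) n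

/-- Remark 1 after Theorem 2.8 with `φ(t) = a t`: an `a`-contraction, `a ∈ [0, 1)`, is a
`φ`-contraction for the (c)-comparison function `t ↦ a t` (so Theorem 2.1 is a special case).
[cite: Berinde2007, Ch. 2 §2.5 Example 2.8 (1)] -/
theorem of_lipschitzWith {a : NNReal} (hT : LipschitzWith a T) :
    IsPhiContraction T (fun t => (a : ℝ) * t) := fun x y => hT.dist_le_mul x y

end IsPhiContraction

/-- Example 2.8 (1): `φ(t) = a t` with `a ∈ [0, 1)` is a (c)-comparison function.
[cite: Berinde2007, Ch. 2 §2.5 Example 2.8 (1)] -/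
theorem isCComparisonFunction_mul {a : ℝ} (ha0 : 0 ≤ a) (ha1 : a < 1) :
    IsCComparisonFunction (fun t => a * t) where
  mono := fun _ _ h => mul_le_mul_of_nonneg_left h ha0
  nonneg t ht := mul_nonneg ha0 ht
  summable_iterate t ht := by
    have hit : ∀ n, (fun t => a * t)^[n] t = t * a ^ n := by
      intro n
      induction n with
      | zero => simp
      | succ n ih => rw [iterate_succ_apply', ih]; ring
    simp_rw [hit]
    exact (summable_geometric_of_lt_one ha0 ha1).mul_left t

/-- Example 2.8 (1): `φ(t) = a t` with `a ∈ [0, 1)` is a comparison function.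
[cite: Berinde2007, Ch. 2 §2.5 Example 2.8 (1)] -/
theorem isComparisonFunction_mul {a : ℝ} (ha0 : 0 ≤ a) (ha1 : a < 1) :
    IsComparisonFunction (fun t => a * t) :=
  (isCComparisonFunction_mul ha0 ha1).isComparisonFunction

end Literature.Analysis.Convex.PhiContractions
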